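import Summits.QuantumFields.BalabanUV.T4Continuum.Support.GradedSubBlocksRefine
import Summits.QuantumFields.BalabanUV.T4Continuum.Support.ScalarBlockPoincare

/-!
# T⁴ programme, spine node NE2 (U1a), sub-row Δ1 — THE GRADED WELL, file 1c: THE SUB-BLOCK POINCARÉ INEQUALITY AT SCALE `s`
# `nsq (f − Π_s f) ≤ 4d·Σ_ν nsq (∂_ν f)` on one torus `Tor N` (`Π_s` = the scale-`s` block-mean projector, `∂_ν = n(S_ν − 1)`, `s ≤ n`)

Row NE2 OWNER (unit `b2b-balaban-t4-ne2-p1`, gen 16), toward socket (GW-S0) of RULING R47 (coercivity of the graded scalar operator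
`DpGW`).  This is leaf-09's `Support/ScalarBlockPoincare.nsq_sub_PiS_le` (unit blocks of `Tor (fine n M)`, rows `Tor M`) RE-RUN AT AN
ARBITRARY SCALE `s ∣ N_ν`, `s ≤ n`, with the ANCHOR-indexed means of file 1 (`GradedSubBlocks.meanS`) — the same translation-average
argument: `f − Π_s f = (f − boxAvg_s f) + (boxAvg_s f − Π_s f)`, the box average at a site of offset `j₀` minus its sub-block mean is the
sub-block mean of the `j₀`-translation defect, and straight-line defects of length `≤ s ≤ n` cost `≤ nsq (∂_ν f)` per direction.

 * §1 offsets `offV`, `legS`, `offV_eq_sum_legS`, `nsq_transS_offV_sub_le` (`≤ d·Σ_ν nsq ∂_ν f` for `s ≤ n`), `boxAvgS`, `nsq_sub_boxAvgS_le`;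
 * §2 the scale-`s` projector `PiSc N s := s^d·Q′_sᴴQ′_s`, `PiSc_mulVec` (`(Π_s f)(x) = (Q′_s f)(anchorOf x)`), `PiSc_apply_site`, the key
   identity `boxAvgS_sub_PiSc_apply`, `sum_sites_eq` (sites = ⊔ sub-blocks, real sums), `nsq_meanS_mulVec_le` (`≤ s^{−d}·nsq`),
   `nsq_boxAvgS_sub_PiSc_le`, **`nsq_sub_PiSc_le`**; and `nsq_PiSc_eq` (`nsq (Π_s f) = s^d·nsq (Q′_s f)`).

HONEST FRAMING (T4-DAG p. 1).  [folklore] lattice calculus at `U = 1`; constants ours; no conditional of the cell; NE2 (U1a) NOT proved; spine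
PROVED 0/9 unchanged; NOT [B9] (3.16)/(3.23)–(3.27) as printed; NOT infinite volume / mass gap / Clay.  HONEST DEPENDENCY: continuum YM on T⁴ ⇐
BetaPertH ∧ nine spine estimates (0/9 proved); BetaPertH ⇐ (D1) ∧ (D4) ∧ CAP+tail; G-an2-4 gates asym, D1 and NE2/3/4.  No `sorry`.
-/

noncomputable section

open scoped BigOperators ComplexConjugate Matrix Matrix.Norms.L2Operator
open Finset

namespace Summit.QuantumFields.BalabanUV.T4Continuum.GradedSubBlocksPoincare

open Literature.MathematicalPhysics.QuantumFieldTheory.Balaban1983to89.B5Prop11Plancherel (Tor unitVec)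
open Literature.MathematicalPhysics.QuantumFieldTheory.Balaban1983to89.B5Prop11Lower (nsq nsq_nonneg)
open Literature.MathematicalPhysics.QuantumFieldTheory.Balaban1983to89.B5Block118 (tstep)
open Literature.MathematicalPhysics.QuantumFieldTheory.Balaban1983to89.B5Action121 (sdiff)
open Summit.QuantumFields.BalabanUV.T4Continuum
open Summit.QuantumFields.BalabanUV.T4Continuum.ScalarBlockPoincare (nsq_sum_le nsq_add_le nsq_smul nsq_sub_comm transS nsq_transS
  nsq_transS_tstep_sub_le_sdiff nsq_transS_partialSum_sub_le)
open Summit.QuantumFields.BalabanUV.T4Continuum.BalabanBlockPoincare (nsq_mulVec_le_rect)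
open Summit.QuantumFields.BalabanUV.T4Continuum.GradedSubBlocks (Anchor Anc InSub site meanS s_pos sum_inSub inSub_site meanS_mulVec
  meanS_mul_conjTranspose sum_offsets_one)
open Summit.QuantumFields.BalabanUV.T4Continuum.GradedSubBlocksRefine (anchorOf sum_anchor_inSub eq_anchorOf_of_inSub)

variable {d : ℕ} (N : Fin d → ℕ) [hN : ∀ ν, NeZero (N ν)] (s : ℕ) [NeZero s]

/-! ## §1 Offsets, straight-line defects, the box translation average -/

/-- the offset `j ∈ [0,s)^d` as a torus vector. [folklore] -/
def offV (j : Fin d → Fin s) : Tor N := fun ν => ((j ν : ℕ) : ZMod (N ν))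

omit hN [NeZero s] in
/-- `site z j = z + offV j`. [folklore] -/
theorem site_eq_add_offV (z : Tor N) (j : Fin d → Fin s) : site N s z j = z + offV N s j := rfl

/-- the `i`-th leg of an offset (a straight step in direction `i`). [folklore] -/
def legS (j : Fin d → Fin s) (i : ℕ) : Tor N := if h : i < d then tstep N ⟨i, h⟩ (j ⟨i, h⟩ : ℕ) else 0

omit hN [NeZero s] in
/-- an offset is the sum of its legs. [folklore] -/
theorem offV_eq_sum_legS (j : Fin d → Fin s) : offV N s j = ∑ i ∈ Finset.range d, legS N s j i := by
  rw [← Fin.sum_univ_eq_sum_range (fun i => legS N s j i) d]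
  have e : ∀ ν : Fin d, legS N s j (ν : ℕ) = tstep N ν (j ν : ℕ) := fun ν => by
    simp only [legS, ν.is_lt, dif_pos]
  rw [Finset.sum_congr rfl fun ν _ => e ν]
  funext μ
  rw [Finset.sum_apply, Finset.sum_eq_single μ (fun ν _ hν => by simp [tstep, Ne.symm hν]) (fun h => absurd (Finset.mem_univ μ) h)]
  simp [tstep, offV]

omit [NeZero s] in
/-- **the offset defect at scale `s ≤ n`**: `nsq (f(· + j) − f) ≤ d·Σ_ν nsq (∂_ν f)`, `∂_ν = n(S_ν − 1)`. [folklore] -/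
theorem nsq_transS_offV_sub_le (n : ℕ) (hsn : s ≤ n) (j : Fin d → Fin s) (f : Tor N → ℂ) :
    nsq (transS N (offV N s j) f - f) ≤ d * ∑ ν, nsq (sdiff N (n : ℂ) ν *ᵥ f) := by
  rw [offV_eq_sum_legS]
  refine (nsq_transS_partialSum_sub_le N (legS N s j) d f).trans ?_
  refine mul_le_mul_of_nonneg_left ?_ (Nat.cast_nonneg d)
  rw [← Fin.sum_univ_eq_sum_range (fun i => nsq (transS N (legS N s j i) f - f)) d]
  refine Finset.sum_le_sum fun ν _ => ?_
  have e : legS N s j (ν : ℕ) = tstep N ν (j ν : ℕ) := by simp only [legS, ν.is_lt, dif_pos]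
  rw [e]
  exact nsq_transS_tstep_sub_le_sdiff N n ν (le_trans (j ν).is_lt.le hsn) f

/-- the box translation average at scale `s`: `s^{−d}·Σ_{j∈[0,s)^d} f(· + j)`. [folklore] -/
def boxAvgS (f : Tor N → ℂ) : Tor N → ℂ := (((s : ℂ) ^ d)⁻¹) • ∑ j : Fin d → Fin s, transS N (offV N s j) f

omit hN [NeZero s] in
/-- the number of offsets as a real number. [folklore] -/
theorem card_offsets : (Fintype.card (Fin d → Fin s) : ℝ) = (s : ℝ) ^ d := by
  rw [Fintype.card_fun, Fintype.card_fin, Fintype.card_fin]; push_cast; ring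

/-- `nsq (f − boxAvg_s f) ≤ d·Σ_ν nsq (∂_ν f)` (`s ≤ n`). [folklore] -/
theorem nsq_sub_boxAvgS_le (n : ℕ) (hsn : s ≤ n) (f : Tor N → ℂ) :
    nsq (f - boxAvgS N s f) ≤ d * ∑ ν, nsq (sdiff N (n : ℂ) ν *ᵥ f) := by
  have hsd : (0 : ℝ) < (s : ℝ) ^ d := pow_pos (by exact_mod_cast s_pos s) d
  have hsc : ((s : ℂ) ^ d) ≠ 0 := pow_ne_zero _ (by exact_mod_cast (NeZero.ne s))
  set Lb : ℝ := d * ∑ ν, nsq (sdiff N (n : ℂ) ν *ᵥ f) with hLb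
  have e : f - boxAvgS N s f = ((s : ℂ) ^ d)⁻¹ • ∑ j : Fin d → Fin s, (f - transS N (offV N s j) f) := by
    rw [boxAvgS, Finset.sum_sub_distrib, Finset.sum_const, Finset.card_univ, smul_sub]
    have hc : (Fintype.card (Fin d → Fin s)) • f = ((s : ℂ) ^ d) • f := by
      rw [Fintype.card_fun, Fintype.card_fin, Fintype.card_fin, ← Nat.cast_smul_eq_nsmul ℂ]; push_cast; rfl
    rw [hc, smul_smul, inv_mul_cancel₀ hsc, one_smul]
  rw [e, nsq_smul, norm_inv, norm_pow, Complex.norm_natCast]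
  have h1 := nsq_sum_le (Finset.univ : Finset (Fin d → Fin s)) (fun j => f - transS N (offV N s j) f)
  rw [Finset.card_univ, card_offsets] at h1
  have h2 : ∑ j : Fin d → Fin s, nsq (f - transS N (offV N s j) f) ≤ ∑ _j : Fin d → Fin s, Lb :=
    Finset.sum_le_sum fun j _ => by rw [nsq_sub_comm]; exact nsq_transS_offV_sub_le N s n hsn j f
  rw [Finset.sum_const, Finset.card_univ, nsmul_eq_mul, card_offsets] at h2
  calc (((s : ℝ) ^ d)⁻¹) ^ 2 * nsq (∑ j : Fin d → Fin s, (f - transS N (offV N s j) f))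
      ≤ (((s : ℝ) ^ d)⁻¹) ^ 2 * ((s : ℝ) ^ d * ((s : ℝ) ^ d * Lb)) :=
        mul_le_mul_of_nonneg_left (h1.trans (mul_le_mul_of_nonneg_left h2 hsd.le)) (by positivity)
    _ = Lb := by field_simp

/-! ## §2 The scale-`s` block-mean projector and the Poincaré inequality -/

/-- **THE SCALE-`s` BLOCK-MEAN PROJECTOR** `Π_s = s^d·Q′_sᴴQ′_s` (`(Π_s f)(x)` = the mean of `f` over the sub-block of `x`).
[cite: Balaban1984PropagatorsI, (1.20) p.20 (shape: block means)] [folklore] -/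
def PiSc : Matrix (Tor N) (Tor N) ℂ := ((s : ℂ) ^ d) • ((meanS N s)ᴴ * meanS N s)

/-- `(Q′_sᴴ g)(x) = s^{−d}·g(anchorOf x)`. [folklore] -/
theorem meanS_conjTranspose_mulVec (g : Anc N s → ℂ) (x : Tor N) :
    ((meanS N s)ᴴ *ᵥ g) x = ((s : ℂ) ^ d)⁻¹ * g (anchorOf N s x) := by
  simp only [Matrix.mulVec, dotProduct, Matrix.conjTranspose_apply, meanS]
  have e : ∀ w : Anc N s, star (if InSub N s w.1 x then (((s : ℂ) ^ d)⁻¹) else 0) * g w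
      = if InSub N s w.1 x then ((s : ℂ) ^ d)⁻¹ * g w else 0 := by
    intro w
    split_ifs
    · rw [star_inv₀, star_pow, Complex.star_def, Complex.conj_natCast]
    · simp
  simp_rw [e]
  rw [sum_anchor_inSub N s x (fun w => ((s : ℂ) ^ d)⁻¹ * g w)]

/-- `(Π_s f)(x) = (Q′_s f)(anchorOf x)`. [folklore] -/
theorem PiSc_mulVec (f : Tor N → ℂ) (x : Tor N) : (PiSc N s *ᵥ f) x = (meanS N s *ᵥ f) (anchorOf N s x) := by
  have hsc : ((s : ℂ) ^ d) ≠ 0 := pow_ne_zero _ (by exact_mod_cast (NeZero.ne s))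
  unfold PiSc
  rw [Matrix.smul_mulVec, ← Matrix.mulVec_mulVec, Pi.smul_apply, meanS_conjTranspose_mulVec, smul_eq_mul, ← mul_assoc,
    mul_inv_cancel₀ hsc, one_mul]

/-- at a site of offset `j₀` in the sub-block of the anchor `z`: `(Π_s f)(z + j₀) = (Q′_s f)(z)`. [folklore] -/
theorem PiSc_apply_site (hs : ∀ ν, s ∣ N ν) (f : Tor N → ℂ) (z : Anc N s) (j₀ : Fin d → Fin s) :
    (PiSc N s *ᵥ f) (site N s z.1 j₀) = (meanS N s *ᵥ f) z := by
  rw [PiSc_mulVec, ← eq_anchorOf_of_inSub N s (inSub_site N s hs z.2 j₀)]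

/-- THE KEY IDENTITY AT SCALE `s`: `(boxAvg_s f − Π_s f)(z + j₀) = (Q′_s(f(· + j₀) − f))(z)`. [folklore] -/
theorem boxAvgS_sub_PiSc_apply (hs : ∀ ν, s ∣ N ν) (f : Tor N → ℂ) (z : Anc N s) (j₀ : Fin d → Fin s) :
    boxAvgS N s f (site N s z.1 j₀) - (PiSc N s *ᵥ f) (site N s z.1 j₀)
      = (meanS N s *ᵥ (transS N (offV N s j₀) f - f)) z := by
  rw [PiSc_apply_site N s hs, meanS_mulVec N s hs, meanS_mulVec N s hs, boxAvgS]
  simp only [Pi.smul_apply, Finset.sum_apply, Pi.sub_apply, transS, smul_eq_mul, Finset.sum_sub_distrib, mul_sub]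
  congr 1
  congr 1
  refine Finset.sum_congr rfl fun j _ => ?_
  rw [site_eq_add_offV, site_eq_add_offV, add_right_comm]

/-- **SITES = ⊔ SUB-BLOCKS** (real sums): `Σ_x g(x) = Σ_{z : anchors} Σ_{j∈[0,s)^d} g(z + j)`. [folklore] -/
theorem sum_sites_eq (hs : ∀ ν, s ∣ N ν) (g : Tor N → ℝ) :
    ∑ x, g x = ∑ z : Anc N s, ∑ j : Fin d → Fin s, g (site N s z.1 j) := by
  have hC : ((∑ x, g x : ℝ) : ℂ) = ((∑ z : Anc N s, ∑ j : Fin d → Fin s, g (site N s z.1 j) : ℝ) : ℂ) := by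
    push_cast
    have e1 : ∀ x : Tor N, ((g x : ℝ) : ℂ) = ∑ z : Anc N s, (if InSub N s z.1 x then ((g x : ℝ) : ℂ) else 0) := fun x => by
      rw [sum_anchor_inSub N s x (fun _ => ((g x : ℝ) : ℂ))]
    rw [Finset.sum_congr rfl fun x _ => e1 x, Finset.sum_comm]
    refine Finset.sum_congr rfl fun z _ => ?_
    rw [sum_inSub N s hs z.2 (fun x => ((g x : ℝ) : ℂ))]
  exact_mod_cast hC

/-- the block Cauchy–Schwarz: `nsq (Q′_s g) ≤ s^{−d}·nsq g`. [folklore] -/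
theorem nsq_meanS_mulVec_le (hs : ∀ ν, s ∣ N ν) (g : Tor N → ℂ) : nsq (meanS N s *ᵥ g) ≤ ((s : ℝ) ^ d)⁻¹ * nsq g := by
  have hsd : (0 : ℝ) ≤ ((s : ℝ) ^ d)⁻¹ := inv_nonneg.mpr (pow_nonneg (Nat.cast_nonneg _) _)
  have hn : ‖meanS N s‖ ^ 2 ≤ ((s : ℝ) ^ d)⁻¹ := by
    rw [sq, ← Matrix.l2_opNorm_conjTranspose, ← Matrix.l2_opNorm_conjTranspose_mul_self, Matrix.conjTranspose_conjTranspose,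
      meanS_mul_conjTranspose N s hs]
    refine (norm_smul_le _ _).trans ?_
    have h1 : ‖(((s : ℂ) ^ d)⁻¹)‖ = ((s : ℝ) ^ d)⁻¹ := by rw [norm_inv, norm_pow, Complex.norm_natCast]
    rw [h1]
    have h2 : ‖(1 : Matrix (Anc N s) (Anc N s) ℂ)‖ ≤ 1 := by
      rw [Matrix.cstar_norm_def, map_one]; exact ContinuousLinearMap.norm_id_le
    calc ((s : ℝ) ^ d)⁻¹ * ‖(1 : Matrix (Anc N s) (Anc N s) ℂ)‖ ≤ ((s : ℝ) ^ d)⁻¹ * 1 := mul_le_mul_of_nonneg_left h2 hsd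
      _ = ((s : ℝ) ^ d)⁻¹ := mul_one _
  exact (nsq_mulVec_le_rect _ g).trans (mul_le_mul_of_nonneg_right hn (nsq_nonneg g))

/-- `nsq (boxAvg_s f − Π_s f) ≤ d·Σ_ν nsq (∂_ν f)` (`s ≤ n`). [folklore] -/
theorem nsq_boxAvgS_sub_PiSc_le (hs : ∀ ν, s ∣ N ν) (n : ℕ) (hsn : s ≤ n) (f : Tor N → ℂ) :
    nsq (boxAvgS N s f - PiSc N s *ᵥ f) ≤ d * ∑ ν, nsq (sdiff N (n : ℂ) ν *ᵥ f) := by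
  have hsd : (0 : ℝ) < (s : ℝ) ^ d := pow_pos (by exact_mod_cast s_pos s) d
  set Lb : ℝ := d * ∑ ν, nsq (sdiff N (n : ℂ) ν *ᵥ f) with hLb
  have e1 : nsq (boxAvgS N s f - PiSc N s *ᵥ f)
      = ∑ j₀ : Fin d → Fin s, nsq (meanS N s *ᵥ (transS N (offV N s j₀) f - f)) := by
    unfold nsq
    rw [sum_sites_eq N s hs (fun x => ‖(boxAvgS N s f - PiSc N s *ᵥ f) x‖ ^ 2), Finset.sum_comm]
    refine Finset.sum_congr rfl fun j₀ _ => Finset.sum_congr rfl fun z _ => ?_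
    rw [Pi.sub_apply, boxAvgS_sub_PiSc_apply N s hs]
  rw [e1]
  calc ∑ j₀ : Fin d → Fin s, nsq (meanS N s *ᵥ (transS N (offV N s j₀) f - f))
      ≤ ∑ _j₀ : Fin d → Fin s, ((s : ℝ) ^ d)⁻¹ * Lb :=
        Finset.sum_le_sum fun j₀ _ => (nsq_meanS_mulVec_le N s hs _).trans
          (mul_le_mul_of_nonneg_left (nsq_transS_offV_sub_le N s n hsn j₀ f) (inv_nonneg.mpr hsd.le))
    _ = Lb := by rw [Finset.sum_const, Finset.card_univ, nsmul_eq_mul, card_offsets]; field_simp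

/-- **THE SUB-BLOCK POINCARÉ INEQUALITY AT SCALE `s`**: `nsq (f − Π_s f) ≤ 4d·Σ_ν nsq (∂_ν f)`, `∂_ν = n(S_ν − 1)`, for every `s ∣ N_ν`
with `s ≤ n` — uniform in `s`, `n` and the torus. [folklore] -/
theorem nsq_sub_PiSc_le (hs : ∀ ν, s ∣ N ν) (n : ℕ) (hsn : s ≤ n) (f : Tor N → ℂ) :
    nsq (f - PiSc N s *ᵥ f) ≤ 4 * d * ∑ ν, nsq (sdiff N (n : ℂ) ν *ᵥ f) := by
  have e : f - PiSc N s *ᵥ f = (f - boxAvgS N s f) + (boxAvgS N s f - PiSc N s *ᵥ f) := by abel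
  rw [e]
  refine (nsq_add_le _ _).trans ?_
  have h1 := nsq_sub_boxAvgS_le N s n hsn f
  have h2 := nsq_boxAvgS_sub_PiSc_le N s hs n hsn f
  linarith

/-- `Σ_x |(Π_s f)(x)|²` over the sub-block of `z` is `s^d·|(Q′_s f)(z)|²`; globally `nsq (Π_s f) = s^d·nsq (Q′_s f)`. [folklore] -/
theorem nsq_PiSc_eq (hs : ∀ ν, s ∣ N ν) (f : Tor N → ℂ) :
    nsq (PiSc N s *ᵥ f) = (s : ℝ) ^ d * nsq (meanS N s *ᵥ f) := by
  unfold nsq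
  rw [sum_sites_eq N s hs (fun x => ‖(PiSc N s *ᵥ f) x‖ ^ 2), Finset.mul_sum]
  refine Finset.sum_congr rfl fun z _ => ?_
  simp_rw [PiSc_apply_site N s hs]
  rw [Finset.sum_const, Finset.card_univ, nsmul_eq_mul, card_offsets]

end Summit.QuantumFields.BalabanUV.T4Continuum.GradedSubBlocksPoincare

end
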